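import Mathlib

/-!
# Imbrie (2016), three-spin block: RIGIDITY of the Ω-land family
# `𝔥(x) = Z₁Z₃ + x₁Z₁ + x₂Z₃ + x₃X₁ + x₄X₃`

[cite: ImbrieJSP2016, eq. (1.1), assumption LLA(ν, C)]  Repair cell b2b-imbrie, LLA.md block P,
P14(a).  Inside a coincident σ₂-sector ("Ω-land") the exact Schrieffer–Wolff reduction of the
three-spin block of [ImbrieJSP2016, eq. (1.1)] is, after rescaling by the induced coupling, a small
deformation of the two-qubit family `𝔥(x) = Z₁Z₃ + x₁Z₁ + x₂Z₃ + x₃X₁ + x₄X₃` (spins 1 and 3).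
LEMMA (LLA.md P14(a)): `𝔥(x)` has a multiple eigenvalue only if `x₃x₄ = 0`.

Proof formalised here as pure algebra.  Order the basis by `s₃ = ±`; then
`𝔥 = [[A + D, x₄·1], [x₄·1, A − D]]` with `A = x₁Z + x₃X`, `D = Z + x₂` (2×2 blocks in the
`s₁`-space).  Writing an eigenvector as `(p, m)` (`p` = the `s₃ = +` component, `m` = the `s₃ = −`
component), the eigen-equations are the four scalar identities `h1a, h1b, h2a, h2b` below, and they
force `N′ p = 0` for the explicit 2×2 matrix
`N′ = x₄² − (A − D − E)(A + D − E) = c·1 + 2E·A + 2x₂·Z − 2x₃·J`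
(`theorem eigen_rows`; no hypothesis on `x₄` is needed for this direction).  If `x₄ ≠ 0` the
`m`-component is determined by `p` (`theorem minus_determined`), so a two-dimensional eigenspace
contains eigenvectors with linearly independent `p`-components; two such force `N′ = 0`, and the
antisymmetric part `−2x₃J` of `N′` gives `x₃ = 0` (`theorem rigidity`).  By the `1 ↔ 3` symmetry,
`x₃ ≠ 0` forces `x₄ = 0` likewise.  Consequences (LLA.md P14(a), Corollary): every double point of
`𝔥` is split at speed 2 by a one-body direction; triple points are `(±1, ±1, 0, 0)`.
-/

namespace Literature.MathematicalPhysics.QuantumLattice.Imbrie2016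

namespace OmegaLandRigidity

/-- [cite: ImbrieJSP2016, eq. (1.1)] The eigen-equations of `𝔥(x)` at eigenvalue `E` for the vector
with `s₃ = +` component `(p0, p1)` and `s₃ = −` component `(m0, m1)` (basis `s₁ = +, −` inside each
component) imply `N′ p = 0`, written out row by row. -/
theorem eigen_rows (E x₁ x₂ x₃ x₄ p0 p1 m0 m1 : ℝ)
    (h1a : (x₁ + 1 + x₂) * p0 + x₃ * p1 + x₄ * m0 = E * p0)
    (h1b : x₃ * p0 + (-x₁ - 1 + x₂) * p1 + x₄ * m1 = E * p1)
    (h2a : x₄ * p0 + (x₁ - 1 - x₂) * m0 + x₃ * m1 = E * m0)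
    (h2b : x₄ * p1 + x₃ * m0 + (-x₁ + 1 - x₂) * m1 = E * m1) :
    (x₄ ^ 2 - x₁ ^ 2 - x₃ ^ 2 - E ^ 2 + 1 + x₂ ^ 2 + 2 * E * x₁ + 2 * x₂) * p0
        + (2 * E * x₃ + 2 * x₃) * p1 = 0 ∧
    (2 * E * x₃ - 2 * x₃) * p0
        + (x₄ ^ 2 - x₁ ^ 2 - x₃ ^ 2 - E ^ 2 + 1 + x₂ ^ 2 - 2 * E * x₁ - 2 * x₂) * p1 = 0 := by
  constructor
  · linear_combination (-(x₁ - 1 - x₂ - E)) * h1a + (-x₃) * h1b + x₄ * h2a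
  · linear_combination (-x₃) * h1a + (-(-x₁ + 1 - x₂ - E)) * h1b + x₄ * h2b

/-- [cite: ImbrieJSP2016, eq. (1.1)] If `x₄ ≠ 0`, the `s₃ = −` component of an eigenvector is
determined by its `s₃ = +` component (so `v ↦ v₊` is injective on an eigenspace). -/
theorem minus_determined (E x₁ x₂ x₃ x₄ p0 p1 m0 m1 : ℝ) (hx : x₄ ≠ 0)
    (h1a : (x₁ + 1 + x₂) * p0 + x₃ * p1 + x₄ * m0 = E * p0)
    (h1b : x₃ * p0 + (-x₁ - 1 + x₂) * p1 + x₄ * m1 = E * p1) :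
    m0 = (E * p0 - (x₁ + 1 + x₂) * p0 - x₃ * p1) / x₄ ∧
      m1 = (E * p1 - x₃ * p0 - (-x₁ - 1 + x₂) * p1) / x₄ := by
  constructor
  · field_simp
    linear_combination h1a
  · field_simp
    linear_combination h1b

/-- [cite: ImbrieJSP2016, eq. (1.1)] RIGIDITY: two eigenvectors of `𝔥(x)` with the same eigenvalue
`E` whose `s₃ = +` components `(p0, p1)`, `(q0, q1)` are linearly independent force `x₃ = 0`.
(With `x₄ ≠ 0` a two-dimensional eigenspace always supplies such a pair, by `minus_determined`;
hence a multiple eigenvalue of `𝔥(x)` requires `x₃ x₄ = 0`.) -/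
theorem rigidity (E x₁ x₂ x₃ x₄ p0 p1 m0 m1 q0 q1 n0 n1 : ℝ)
    (h1a : (x₁ + 1 + x₂) * p0 + x₃ * p1 + x₄ * m0 = E * p0)
    (h1b : x₃ * p0 + (-x₁ - 1 + x₂) * p1 + x₄ * m1 = E * p1)
    (h2a : x₄ * p0 + (x₁ - 1 - x₂) * m0 + x₃ * m1 = E * m0)
    (h2b : x₄ * p1 + x₃ * m0 + (-x₁ + 1 - x₂) * m1 = E * m1)
    (g1a : (x₁ + 1 + x₂) * q0 + x₃ * q1 + x₄ * n0 = E * q0)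
    (g1b : x₃ * q0 + (-x₁ - 1 + x₂) * q1 + x₄ * n1 = E * q1)
    (g2a : x₄ * q0 + (x₁ - 1 - x₂) * n0 + x₃ * n1 = E * n0)
    (g2b : x₄ * q1 + x₃ * n0 + (-x₁ + 1 - x₂) * n1 = E * n1)
    (hdet : p0 * q1 - p1 * q0 ≠ 0) : x₃ = 0 := by
  obtain ⟨e1, e2⟩ := eigen_rows E x₁ x₂ x₃ x₄ p0 p1 m0 m1 h1a h1b h2a h2b
  obtain ⟨e3, e4⟩ := eigen_rows E x₁ x₂ x₃ x₄ q0 q1 n0 n1 g1a g1b g2a g2b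
  -- β := N′₀₁ = 2x₃(E + 1), γ := N′₁₀ = 2x₃(E − 1); both vanish because N′ kills a basis.
  have hβ : (2 * E * x₃ + 2 * x₃) * (p0 * q1 - p1 * q0) = 0 := by
    linear_combination p0 * e3 - q0 * e1
  have hγ : (2 * E * x₃ - 2 * x₃) * (p0 * q1 - p1 * q0) = 0 := by
    linear_combination q1 * e2 - p1 * e4
  have hb : 2 * E * x₃ + 2 * x₃ = 0 := (mul_eq_zero.mp hβ).resolve_right hdet
  have hg : 2 * E * x₃ - 2 * x₃ = 0 := (mul_eq_zero.mp hγ).resolve_right hdet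
  linear_combination (hb - hg) / 4

/-- [cite: ImbrieJSP2016, eq. (1.1)] The antisymmetric part of `N′`: the difference of its
off-diagonal entries is `4x₃` (the `−2x₃J` term of LLA.md P14(a)), recorded as an identity. -/
theorem Nprime_antisymmetric_part (E x₃ : ℝ) :
    (2 * E * x₃ + 2 * x₃) - (2 * E * x₃ - 2 * x₃) = 4 * x₃ := by ring

end OmegaLandRigidity

end Literature.MathematicalPhysics.QuantumLattice.Imbrie2016
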